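import Literature.Geometry.Lorentzian.KerrTimeDominatedCurrent
import HarnessLib

/-!
# The combined current `Q = Q^f + Ϙ^h + ϟ^y − E(χ₂Q^T + χ₁Q^K)` of the frequency-localised
# multiplier estimates: derivative, boundary values under (b±), the integrated identity and the
# deduction "bulk coercivity + boundary positivity ⇒ estimate"
# (Dafermos–Rodnianski–Shlapentokh-Rothman, §8.2; Stage 1–3 of §8.3)

(family `gr`, infrastructure for statement **gr.S24**; namespace `Literature.Geometry.Lorentzian.Kerr`)

Dafermos–Rodnianski–Shlapentokh-Rothman (*Decay for solutions of the wave equation on Kerr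
exterior spacetimes III*, arXiv:1402.7034 = Ann. of Math. 183 (2016)) prove the frequency-localised
multiplier estimates of their Theorem 8.1 as follows (§8.2, "Overview"): for each admissible
triple `(ω, m, Λ)` one finds "a current `Q` consisting of various combinations of `Q^f`, `ϟ^y`,
`Ϙ^h`, `Q^T` and `Q^K`" (the templates of §7, `KerrSeparatedCurrents.lean`; the energy currents
enter with cut-offs, `−Eχ₁Q^K − Eχ₂Q^T`, §8.3) "satisfying the bulk coercivity property
(yaxvw) `∫ Q'[u] ≥ b ∫_{R₋*}^{R₊*} (|u'|² + (1 − r⁻¹r_trap)²(Λ + ω²)|u|² + |u|²) − ∫ H·(f,h,y,χ)·(u,u')`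
and, ideally, the boundary positivity property (boundaryOK) `Q(∞) − Q(−∞) ≤ 0`", the boundary
values being computed from the boundary conditions (eq:b+) `u' − iωu → 0` (`r* → ∞`) and (eq:b−)
`u' + i(ω − ω₊m)u → 0` (`r* → −∞`) of §5.3, e.g. (microEnergyEst)
`∫ (Q^T)' = Q^T(∞) − Q^T(−∞) = ω²|u(∞)|² + ω(ω − ω₊m)|u(−∞)|²`; the estimate (fromPhaseSpace2) of
Theorem 8.1 then follows from `∫ Q' = Q(∞) − Q(−∞)`. For the bounded non-small frequencies of
§8.7 only the weaker (boundaryNotOK) `Q(∞) − Q(−∞) ≤ B|u(−∞)|²` is available, which is the origin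
of the term `1_{…}|u(−∞)|²` in (fromPhaseSpace2).

This file **proves** this skeleton once and for all, for arbitrary real potentials `V` and
multiplier functions on `ℝ` (the variable is `x = r*`) and an arbitrary real parameter `ϖ` in the
role of `ω − ω₊m`:

* `Multipliers` bundles the functions `f, h, y, χ₁, χ₂` with the derivative functions entering
  `Q` and `Q'` (`Multipliers.HasDerivs`; end behaviour `Multipliers.EndLimits`), and
  `OutgoingBoundary ω ϖ V u u' A_∞ A_H` bundles (eq:b±) with `|u|² → A_∞, A_H`, `V → 0`,
  `V → ω² − ϖ²`; `combinedCurrent` is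
  `Q = Q^f + Ϙ^h + ϟ^y − E(χ₂Q^T + χ₁Q^K)` (`Q^K = ϖ Im(u'ū)`, cf. `energyCurrentK_eq_energyCurrentT`),
  `combinedBulk` its bulk
  `2f'|u'|² − fV'|u|² − ½f'''|u|² + h(|u'|² + (V − ω²)|u|²) − ½h''|u|² + y'(|u'|² + (ω² − V)|u|²)
   − yV'|u|² − E(χ₂'ω + χ₁'ϖ) Im(u'ū)`
  and `combinedSource` the "data" term
  `−2f Re(u'H̄) − (f' + h) Re(uH̄) − 2y Re(u'H̄) + E(χ₂ω + χ₁ϖ) Im(Hū)` (the right-hand sides of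
  Propositions 8.3.1–8.6.1); `hasDerivAt_combinedCurrent`: `Q' = bulk − source` for solutions of
  `u'' + (ω² − V)u = H` (§7.1–§7.2 combined).
* Boundary values (`tendsto_combinedCurrent_atTop/atBot`): under (eq:b+) with `|u|² → A_∞`,
  `V → 0` and multiplier limits `f → f_∞`, `f'' → 0`, `h' → 0`, `y → y_∞`, `χᵢ → χᵢ_∞` (`f'`, `h`
  merely convergent) one has `Q(∞) = (2(f_∞ + y_∞)ω² − E(χ₂_∞ω² + χ₁_∞ϖω)) A_∞`, and under (eq:b−)
  with `|u|² → A_H`, `V → ω² − ϖ²`: `Q(−∞) = (2(f_H + y_H)ϖ² + E(χ₂_H ωϖ + χ₁_H ϖ²)) A_H` — e.g.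
  `(|u'|² + ω²|u|²)_{r=∞} = 2ω²A_∞`, `(|u'|² + (ω − ω₊m)²|u|²)_{r=r₊} = 2ϖ²A_H` in (metastra).
* `integral_combinedBulk_eq`: `∫ bulk = Q(∞) − Q(−∞) + ∫ source`;
  `integrable_combinedBulk_of_nonneg`: a non-negative bulk is automatically integrable;
  `combined_estimate`: if the bulk is `≥ 0` on `ℝ` and `≥ b(|u'|² + w|u|²)` on `[R₁, R₂]` then
  `b ∫_{R₁}^{R₂} (|u'|² + w|u|²) ≤ ∫ source + (Q(∞) − Q(−∞))` — the deduction of §8.2 with the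
  boundary contribution kept explicit — and `combined_estimate_of_boundary_sign`, its form under
  (boundaryOK) expressed through the signs of the two boundary coefficients.
* Printed instances: (metastra) of §8.3, Stage 1 (`integral_virialBulk_eq`); (microEnergyEst) of
  §8.2 (`integral_omega_mul_im_eq`); the horizon-flux control of §8.3, Stage 3,
  `(|u'|² + (ω − ω₊m)²|u|²)_{r=r₊} ≤ E ∫ (χ₁Q^K)' = E ∫ χ₁'ϖ Im(u'ū) + E ∫ χ₁ϖ Im(Hū)` for `E ≥ 2`
  (`integral_cutoff_flux_eq`, `horizonFlux_le_mul_integral_cutoff`), with the pointwise bound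
  `|ϖ Im(u'ū)| ≤ ½(|u'|² + ϖ²|u|²)` used there (`abs_mul_im_mul_conj_le`).

The time-dominated current `ϟ^y − E·Q^T` of `KerrTimeDominatedCurrent.lean` (Prop. 8.4.1) is the
case `f = h = χ₁ = 0`, `χ₂ = 1`; this file re-uses its plane-wave lemmas and its integrability
lemma `integrable_of_hasDerivAt_add_of_nonneg`. Sign conventions: with `(Q^T)' = ω Im(Hū)`,
`(Ϙ^h)' = … + h Re(uH̄)` (§7) and `∫ Q' = Q(∞) − Q(−∞)`, the data term carries `−(f' + h) Re(uH̄)`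
and `+E(χ₂ω + χ₁ϖ) Im(Hū)`, as in the statements of Propositions 8.3.1, 8.4.1, 8.5.1 (the display
(Hfhy) of Theorem 8.1 prints these two kinds of terms as `+h Re(uH̄)` and `−Eχ₂ω Im(Hū)`,
`−Eχ₁(ω − ω₊m) Im(Hū)`; we follow §7 and the propositions); (microEnergyEst) is printed with
`∫ Im(Hū)` for `∫ (Q^T)' = ∫ ω Im(Hū)`.

## References

* M. Dafermos, I. Rodnianski, Y. Shlapentokh-Rothman, arXiv:1402.7034 = Ann. of Math. 183
  (2016), §5.3 ((eq:b±)), §7.1–§7.2 (currents), §8.2 ((yaxvw), (boundaryOK), (microEnergyEst),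
  (boundaryNotOK)), §8.3 (Stages 1–3 of the proof of Prop. 8.3.1: (metastra), (metatastra2), the
  `χ₁Q^K` argument) (key `DafermosRodnianskiShlapentokhrothman2014`).
-/

noncomputable section

open scoped InnerProductSpace ComplexConjugate
open Filter Topology MeasureTheory Set

namespace Literature.Geometry.Lorentzian

namespace Kerr

/-! ### Plane-wave asymptotics of the virial flux `Re(u'ū)` -/

section PlaneWave

variable {l : Filter ℝ} {u u₁ : ℝ → ℂ} {c : ℂ} {A : ℝ}

/-- `Re(z w̄) = Re((z − cw) w̄) + (Re c)|w|²`. [folklore] -/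
theorem re_mul_conj_eq_add (z w c : ℂ) :
    (z * conj w).re = ((z - c * w) * conj w).re + c.re * ‖w‖ ^ 2 := by
  have h : z * conj w = (z - c * w) * conj w + c * (w * conj w) := by ring
  rw [h, Complex.mul_conj, Complex.normSq_eq_norm_sq, Complex.add_re]
  congr 1
  rw [Complex.mul_re, Complex.ofReal_re, Complex.ofReal_im]
  ring

/-- **Plane-wave asymptotics, the virial flux `Re(u'ū)`**: if `u' − cu → 0` and `|u|² → A` along a
filter then `Re(u'ū) = ⟪u, u'⟫_ℝ → (Re c) A`; for the boundary conditions (eq:b±) of DRSR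
arXiv:1402.7034, §5.3 (`c = iω`, resp. `c = −i(ω − ω₊m)`) the limit is `0`. [folklore] -/
theorem tendsto_inner_of_sub_mul_tendsto_zero
    (hb : Tendsto (fun x ↦ u₁ x - c * u x) l (𝓝 0))
    (hA : Tendsto (fun x ↦ ‖u x‖ ^ 2) l (𝓝 A)) :
    Tendsto (fun x ↦ ⟪u x, u₁ x⟫_ℝ) l (𝓝 (c.re * A)) := by
  have hz : Tendsto (fun x ↦ (u₁ x - c * u x) * conj (u x)) l (𝓝 0) := by
    refine hb.zero_mul_isBoundedUnder_le ?_
    have h := isBoundedUnder_norm_of_tendsto_norm_sq hA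
    simpa only [Function.comp_def, Complex.norm_conj] using h
  have hz' : Tendsto (fun x ↦ ((u₁ x - c * u x) * conj (u x)).re) l (𝓝 0) := by
    simpa only [Function.comp_def, Complex.zero_re] using (Complex.continuous_re.tendsto 0).comp hz
  have key : Tendsto (fun x ↦ ((u₁ x - c * u x) * conj (u x)).re + c.re * ‖u x‖ ^ 2) l
      (𝓝 (c.re * A)) := by
    simpa only [zero_add] using hz'.add (hA.const_mul c.re)
  refine key.congr fun x ↦ ?_
  rw [← re_mul_conj_eq_add, re_mul_conj_eq_inner]

end PlaneWave

/-! ### Boundary values of `Ϙ^h` and `Q^f` along a filter -/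

section BoundaryValues

variable {l : Filter ℝ} {u u₁ : ℝ → ℂ} {c : ℂ} {A ω V₀ f₀ f₁₀ f₂₀ h₀ h₁₀ : ℝ}
  {V f f₁ f₂ h h₁ : ℝ → ℝ}

/-- **Limit of `Ϙ^h`** along a filter: if `h → h₀`, `h' → h₁₀`, `u' − cu → 0`, `|u|² → A` then
`Ϙ^h[u] = h Re(u'ū) − ½h'|u|² → h₀ (Re c) A − ½ h₁₀ A` (`= −½h₁₀A` under (eq:b±), and `0` when
moreover `h' → 0`). DRSR arXiv:1402.7034, §8.3 (the `Ϙ^h` current contributes no boundary terms in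
(metatastra2)). [cite: DafermosRodnianskiShlapentokhrothman2014, §8.3] -/
theorem tendsto_qoppaCurrent (hh : Tendsto h l (𝓝 h₀)) (hh₁ : Tendsto h₁ l (𝓝 h₁₀))
    (hb : Tendsto (fun x ↦ u₁ x - c * u x) l (𝓝 0))
    (hA : Tendsto (fun x ↦ ‖u x‖ ^ 2) l (𝓝 A)) :
    Tendsto (qoppaCurrent h h₁ u u₁) l (𝓝 (h₀ * (c.re * A) - 1 / 2 * h₁₀ * A)) := by
  show Tendsto (fun x ↦ h x * ⟪u x, u₁ x⟫_ℝ - 1 / 2 * h₁ x * ‖u x‖ ^ 2) l _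
  exact (hh.mul (tendsto_inner_of_sub_mul_tendsto_zero hb hA)).sub
    ((hh₁.const_mul (1 / 2)).mul hA)

/-- **Limit of `Q^f`** along a filter: if `f → f₀`, `f' → f₁₀`, `f'' → f₂₀`, `V → V₀`,
`u' − cu → 0`, `|u|² → A` then
`Q^f[u] → f₀(|c|²A + (ω² − V₀)A) + f₁₀ (Re c) A − ½ f₂₀ A`. Under (eq:b+) (`c = iω`, `V₀ = 0`) with
`f' `, `f'' → 0` this is `f₀ · 2ω²A = f(∞)(|u'|² + ω²|u|²)_{r=∞}`, and under (eq:b−)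
(`c = −i(ω − ω₊m)`, `V₀ = ω² − (ω − ω₊m)²`) it is `f(−∞)(|u'|² + (ω − ω₊m)²|u|²)_{r=r₊}`: the
boundary terms of (metastra), DRSR arXiv:1402.7034, §8.3. [cite: DafermosRodnianskiShlapentokhrothman2014, §8.3] -/
theorem tendsto_virialCurrent [l.NeBot] (hf : Tendsto f l (𝓝 f₀)) (hf₁ : Tendsto f₁ l (𝓝 f₁₀))
    (hf₂ : Tendsto f₂ l (𝓝 f₂₀)) (hV : Tendsto V l (𝓝 V₀))
    (hb : Tendsto (fun x ↦ u₁ x - c * u x) l (𝓝 0))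
    (hA : Tendsto (fun x ↦ ‖u x‖ ^ 2) l (𝓝 A)) :
    Tendsto (virialCurrent ω V f f₁ f₂ u u₁) l
      (𝓝 (f₀ * (‖c‖ ^ 2 * A + (ω ^ 2 - V₀) * A) + (f₁₀ * (c.re * A) - 1 / 2 * f₂₀ * A))) := by
  have h1 := tendsto_koppaCurrent (ω := ω) hf hV hb hA
  have h2 := tendsto_qoppaCurrent hf₁ hf₂ hb hA
  exact (h1.add h2).congr fun x ↦ (virialCurrent_eq ω V f f₁ f₂ u u₁ x).symm

/-- `Re(iω) = 0`. [folklore] -/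
theorem I_mul_ofReal_re (ω : ℝ) : (Complex.I * ω).re = 0 := by simp

end BoundaryValues

/-! ### The flux `Im(u'ū)` and the current `Q^K` as a `Q^T` with parameter `ϖ` -/

section Flux

variable {ω x : ℝ} {V : ℝ → ℝ} {u u₁ : ℝ → ℂ} {u₂ H : ℂ}

/-- **Derivative of the flux `Im(u'ū)`**: for `u'' + (ω² − V)u = H` at `x`,
`(Im(u'ū))' = Im(Hū)` (the common content of the two displays of DRSR arXiv:1402.7034, §7.2).
[cite: DafermosRodnianskiShlapentokhrothman2014, §7.2] -/
theorem hasDerivAt_im_mul_conj (hu : HasDerivAt u (u₁ x) x) (hu₁ : HasDerivAt u₁ u₂ x)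
    (hode : u₂ + ((ω ^ 2 - V x : ℝ) : ℂ) * u x = H) :
    HasDerivAt (fun t ↦ (u₁ t * conj (u t)).im) ((H * conj (u x)).im) x := by
  have hIu : HasDerivAt (fun t ↦ Complex.I * u t) (Complex.I * u₁ x) x := hu.const_mul _
  have h1 : HasDerivAt (fun t ↦ ⟪Complex.I * u t, u₁ t⟫_ℝ)
      (⟪Complex.I * u x, u₂⟫_ℝ + ⟪Complex.I * u₁ x, u₁ x⟫_ℝ) x :=
    hIu.inner ℝ hu₁
  have hfun : (fun t ↦ ⟪Complex.I * u t, u₁ t⟫_ℝ) = fun t ↦ (u₁ t * conj (u t)).im := by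
    funext t
    rw [im_mul_conj_eq_inner]
  rw [hfun] at h1
  refine h1.congr_deriv ?_
  have hu₂ : u₂ = H - ((ω ^ 2 - V x : ℝ) : ℂ) * u x := eq_sub_of_add_eq hode
  rw [hu₂, inner_sub_right, inner_ofReal_mul, inner_I_mul_self, inner_I_mul_self,
    im_mul_conj_eq_inner]
  ring

/-- **`(ϖ Im(u'ū))' = ϖ Im(Hū)`** for `u'' + (ω² − V)u = H` at `x` and an arbitrary real `ϖ`
(for `ϖ = ω` this is `(Q^T)'`, for `ϖ = ω − ω₊m` it is `(Q^K)'`; DRSR arXiv:1402.7034, §7.2).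
[cite: DafermosRodnianskiShlapentokhrothman2014, §7.2] -/
theorem hasDerivAt_energyCurrentT_of_ode (ϖ : ℝ) (hu : HasDerivAt u (u₁ x) x)
    (hu₁ : HasDerivAt u₁ u₂ x) (hode : u₂ + ((ω ^ 2 - V x : ℝ) : ℂ) * u x = H) :
    HasDerivAt (energyCurrentT ϖ u u₁) (ϖ * (H * conj (u x)).im) x :=
  (hasDerivAt_im_mul_conj hu hu₁ hode).const_mul ϖ

/-- `Q^K` is the current `Q^T` with `ω` replaced by `ϖ = ω − ω₊m`:
`Q^K[u] = (ω − ω₊m) Im(u'ū)`. DRSR arXiv:1402.7034, §7.2. [cite: DafermosRodnianskiShlapentokhrothman2014, §7.2] -/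
theorem energyCurrentK_eq_energyCurrentT (M a ω : ℝ) (m : ℤ) (u u₁ : ℝ → ℂ) :
    energyCurrentK M a ω m u u₁ = energyCurrentT (ω - horizonAngularVelocity M a * m) u u₁ :=
  rfl

/-- **The pointwise bound on the cut-off error of Stage 3** (DRSR arXiv:1402.7034, §8.3):
`|ϖ Im(u'ū)| ≤ ½(|u'|² + ϖ²|u|²)`, whence
`|E ∫ χ₁'(ω − ω₊m) Im(u'ū)| ≤ E sup|χ₁'| · ½∫_{supp χ₁'} (|u'|² + (ω − ω₊m)²|u|²)`.
[cite: DafermosRodnianskiShlapentokhrothman2014, §8.3] -/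
theorem abs_mul_im_mul_conj_le (ϖ : ℝ) (z w : ℂ) :
    |ϖ * (z * conj w).im| ≤ 1 / 2 * (‖z‖ ^ 2 + ϖ ^ 2 * ‖w‖ ^ 2) := by
  have h1 : |(z * conj w).im| ≤ ‖z‖ * ‖w‖ := by
    calc |(z * conj w).im| ≤ ‖z * conj w‖ := Complex.abs_im_le_norm _
      _ = ‖z‖ * ‖w‖ := by rw [norm_mul, Complex.norm_conj]
  rw [abs_mul]
  have h2 : |ϖ| * |(z * conj w).im| ≤ |ϖ| * (‖z‖ * ‖w‖) :=
    mul_le_mul_of_nonneg_left h1 (abs_nonneg ϖ)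
  have h3 : |ϖ| * (‖z‖ * ‖w‖) ≤ 1 / 2 * (‖z‖ ^ 2 + ϖ ^ 2 * ‖w‖ ^ 2) := by
    have hsq : |ϖ| ^ 2 = ϖ ^ 2 := sq_abs ϖ
    nlinarith [sq_nonneg (‖z‖ - |ϖ| * ‖w‖), abs_nonneg ϖ, norm_nonneg z, norm_nonneg w]
  exact h2.trans h3

end Flux

/-! ### Multiplier data -/

/-- **Multiplier data** for the combined current of DRSR arXiv:1402.7034, §8.2: the functions
`f` (of `Q^f`), `h` (of `Ϙ^h`), `y` (of `ϟ^y`), and the cut-offs `χ₁` (of `Q^K`) and `χ₂` (of `Q^T`),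
as functions of `x = r*`, together with the derivative functions that enter `Q` and `Q'`
(`f', f'', f'''`, `h', h''`, `y'`, `χ₁'`, `χ₂'`; that these are the derivatives is the separate
hypothesis `Multipliers.HasDerivs`). The functions `ŷ`, `ỹ` of Theorem 8.1 are further `ϟ`-weights
and are absorbed into `y` here. [cite: DafermosRodnianskiShlapentokhrothman2014, §8.2] -/
structure Multipliers where
  /-- the weight `f` of the virial current `Q^f` -/
  f : ℝ → ℝ
  /-- `f' = df/dr*` -/
  f' : ℝ → ℝ
  /-- `f''` -/
  f'' : ℝ → ℝ
  /-- `f'''` -/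
  f''' : ℝ → ℝ
  /-- the weight `h` of `Ϙ^h` -/
  h : ℝ → ℝ
  /-- `h'` -/
  h' : ℝ → ℝ
  /-- `h''` -/
  h'' : ℝ → ℝ
  /-- the weight `y` of `ϟ^y` -/
  y : ℝ → ℝ
  /-- `y'` -/
  y' : ℝ → ℝ
  /-- the cut-off `χ₁` of `Q^K` -/
  χ₁ : ℝ → ℝ
  /-- `χ₁'` -/
  χ₁' : ℝ → ℝ
  /-- the cut-off `χ₂` of `Q^T` -/
  χ₂ : ℝ → ℝ
  /-- `χ₂'` -/
  χ₂' : ℝ → ℝ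

namespace Multipliers

/-- The derivative relations between the fields of a `Multipliers` record (everywhere on `ℝ`).
[cite: DafermosRodnianskiShlapentokhrothman2014, §8.2] -/
structure HasDerivs (μ : Multipliers) : Prop where
  /-- `f' = (f)'` -/
  df : ∀ x, HasDerivAt μ.f (μ.f' x) x
  /-- `f'' = (f')'` -/
  df' : ∀ x, HasDerivAt μ.f' (μ.f'' x) x
  /-- `f''' = (f'')'` -/
  df'' : ∀ x, HasDerivAt μ.f'' (μ.f''' x) x
  /-- `h' = (h)'` -/
  dh : ∀ x, HasDerivAt μ.h (μ.h' x) x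
  /-- `h'' = (h')'` -/
  dh' : ∀ x, HasDerivAt μ.h' (μ.h'' x) x
  /-- `y' = (y)'` -/
  dy : ∀ x, HasDerivAt μ.y (μ.y' x) x
  /-- `χ₁' = (χ₁)'` -/
  dχ₁ : ∀ x, HasDerivAt μ.χ₁ (μ.χ₁' x) x
  /-- `χ₂' = (χ₂)'` -/
  dχ₂ : ∀ x, HasDerivAt μ.χ₂ (μ.χ₂' x) x

/-- **End behaviour of the multipliers** along a filter `l` (`atTop` = `r* → ∞`, `atBot` = the
horizon end `r* → −∞`): `f → f₀`, `y → y₀`, `χ₁ → χ₁₀`, `χ₂ → χ₂₀`, `f'' → 0`, `h' → 0`, and `f'`,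
`h` convergent. In DRSR arXiv:1402.7034 all multipliers are eventually constant in `r*` towards
`r* = ∞` (Theorem 8.1: `f + y = 1, f' = 0, h = 0, ŷ = 0, χ₁ = 0, χ₂ = 1` for `r* ≥ R*_∞`, up to the
exponentially decaying `ỹ`) and are smooth functions of `r ∈ [r₊, ∞)`, so that towards the horizon
they converge to their values at `r₊` while their `r*`-derivatives tend to `0`.
[cite: DafermosRodnianskiShlapentokhrothman2014, Thm. 8.1] -/
structure EndLimits (μ : Multipliers) (l : Filter ℝ) (f₀ y₀ χ₁₀ χ₂₀ : ℝ) : Prop where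
  /-- `f → f₀` -/
  tendsto_f : Tendsto μ.f l (𝓝 f₀)
  /-- `f'` converges -/
  tendsto_f' : ∃ c, Tendsto μ.f' l (𝓝 c)
  /-- `f'' → 0` -/
  tendsto_f'' : Tendsto μ.f'' l (𝓝 0)
  /-- `h` converges -/
  tendsto_h : ∃ c, Tendsto μ.h l (𝓝 c)
  /-- `h' → 0` -/
  tendsto_h' : Tendsto μ.h' l (𝓝 0)
  /-- `y → y₀` -/
  tendsto_y : Tendsto μ.y l (𝓝 y₀)
  /-- `χ₁ → χ₁₀` -/
  tendsto_χ₁ : Tendsto μ.χ₁ l (𝓝 χ₁₀)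
  /-- `χ₂ → χ₂₀` -/
  tendsto_χ₂ : Tendsto μ.χ₂ l (𝓝 χ₂₀)

/-- The multiplier data of a pure virial current `Q^f` (`h = y = χ₁ = χ₂ = 0`), as in Stage 1 of
the proof of DRSR arXiv:1402.7034, Prop. 8.3.1. [cite: DafermosRodnianskiShlapentokhrothman2014, §8.3] -/
def virial (f f' f'' f''' : ℝ → ℝ) : Multipliers where
  f := f
  f' := f'
  f'' := f''
  f''' := f'''
  h := 0
  h' := 0
  h'' := 0
  y := 0
  y' := 0
  χ₁ := 0
  χ₁' := 0
  χ₂ := 0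
  χ₂' := 0

/-- Derivative relations for `Multipliers.virial`. [folklore] -/
theorem hasDerivs_virial {f f' f'' f''' : ℝ → ℝ} (hf : ∀ x, HasDerivAt f (f' x) x)
    (hf' : ∀ x, HasDerivAt f' (f'' x) x) (hf'' : ∀ x, HasDerivAt f'' (f''' x) x) :
    (virial f f' f'' f''').HasDerivs where
  df := hf
  df' := hf'
  df'' := hf''
  dh := fun x ↦ hasDerivAt_const x (0 : ℝ)
  dh' := fun x ↦ hasDerivAt_const x (0 : ℝ)
  dy := fun x ↦ hasDerivAt_const x (0 : ℝ)
  dχ₁ := fun x ↦ hasDerivAt_const x (0 : ℝ)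
  dχ₂ := fun x ↦ hasDerivAt_const x (0 : ℝ)

/-- End limits for `Multipliers.virial`: `f → f₀`, `f'` convergent, `f'' → 0` suffice. [folklore] -/
theorem endLimits_virial {f f' f'' f''' : ℝ → ℝ} {l : Filter ℝ} {f₀ c : ℝ}
    (hf : Tendsto f l (𝓝 f₀)) (hf' : Tendsto f' l (𝓝 c)) (hf'' : Tendsto f'' l (𝓝 0)) :
    (virial f f' f'' f''').EndLimits l f₀ 0 0 0 where
  tendsto_f := hf
  tendsto_f' := ⟨c, hf'⟩
  tendsto_f'' := hf''
  tendsto_h := ⟨0, tendsto_const_nhds⟩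
  tendsto_h' := tendsto_const_nhds
  tendsto_y := tendsto_const_nhds
  tendsto_χ₁ := tendsto_const_nhds
  tendsto_χ₂ := tendsto_const_nhds

end Multipliers

/-- **The boundary conditions (eq:b+), (eq:b−) with their plane-wave asymptotics**, for a
function `u(r*)` with derivative function `u'`, frequency `ω`, horizon frequency `ϖ` (`= ω − ω₊m`)
and potential `V`: `u' − iωu → 0`, `|u|² → A_∞`, `V → 0` as `r* → ∞` and `u' + iϖu → 0`,
`|u|² → A_H`, `V → ω² − ϖ²` as `r* → −∞`. DRSR arXiv:1402.7034, §5.3 ((eq:b±), obtained in the proof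
of Lemma 5.4.1 from `u = A_out e^{iωr*} + O(r⁻¹)`, `u = C_out e^{−i(ω−ω₊m)r*} + O(|r*|⁻¹)`), §6.2
(`V → 0` at infinity, `ω² − V(r₊) = (ω − ω₊m)²`, cf. `Kerr.omega_sq_sub_sepPotential_rPlus`).
[cite: DafermosRodnianskiShlapentokhrothman2014, §5.3] -/
structure OutgoingBoundary (ω ϖ : ℝ) (V : ℝ → ℝ) (u u₁ : ℝ → ℂ) (Atop Abot : ℝ) : Prop where
  /-- (eq:b+): `u' − iωu → 0` as `r* → ∞` -/
  sub_top : Tendsto (fun x ↦ u₁ x - Complex.I * ω * u x) atTop (𝓝 0)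
  /-- (eq:b−): `u' + iϖu → 0` as `r* → −∞` -/
  add_bot : Tendsto (fun x ↦ u₁ x + Complex.I * ϖ * u x) atBot (𝓝 0)
  /-- `|u|² → A_∞` as `r* → ∞` -/
  normSq_top : Tendsto (fun x ↦ ‖u x‖ ^ 2) atTop (𝓝 Atop)
  /-- `|u|² → A_H` as `r* → −∞` -/
  normSq_bot : Tendsto (fun x ↦ ‖u x‖ ^ 2) atBot (𝓝 Abot)
  /-- `V → 0` as `r* → ∞` -/
  potential_top : Tendsto V atTop (𝓝 0)
  /-- `V → ω² − ϖ²` as `r* → −∞` -/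
  potential_bot : Tendsto V atBot (𝓝 (ω ^ 2 - ϖ ^ 2))

namespace OutgoingBoundary

variable {ω ϖ Atop Abot : ℝ} {V : ℝ → ℝ} {u u₁ : ℝ → ℂ}

/-- (eq:b−) in the form `u' − cu → 0` with `c = −iϖ`. [folklore] -/
theorem sub_bot (hb : OutgoingBoundary ω ϖ V u u₁ Atop Abot) :
    Tendsto (fun x ↦ u₁ x - -(Complex.I * ϖ) * u x) atBot (𝓝 0) := by
  simpa [sub_neg_eq_add] using hb.add_bot

/-- `A_∞ ≥ 0`. [folklore] -/
theorem nonneg_top (hb : OutgoingBoundary ω ϖ V u u₁ Atop Abot) : 0 ≤ Atop :=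
  nonneg_of_tendsto_norm_sq hb.normSq_top

/-- `A_H ≥ 0`. [folklore] -/
theorem nonneg_bot (hb : OutgoingBoundary ω ϖ V u u₁ Atop Abot) : 0 ≤ Abot :=
  nonneg_of_tendsto_norm_sq hb.normSq_bot

end OutgoingBoundary

/-! ### The combined current, its bulk and its source term -/

/-- **The combined current `Q = Q^f + Ϙ^h + ϟ^y − E(χ₂Q^T + χ₁Q^K)`** of DRSR arXiv:1402.7034,
§8.2/§8.3, as a real function of `x = r*` (`Q^K` written as `ϖ Im(u'ū)` with a real parameter `ϖ`,
`= ω − ω₊m` in loc. cit.). [cite: DafermosRodnianskiShlapentokhrothman2014, §8.3] -/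
def combinedCurrent (ω ϖ E : ℝ) (V : ℝ → ℝ) (μ : Multipliers) (u u₁ : ℝ → ℂ) (x : ℝ) : ℝ :=
  virialCurrent ω V μ.f μ.f' μ.f'' u u₁ x + qoppaCurrent μ.h μ.h' u u₁ x +
    koppaCurrent ω V μ.y u u₁ x -
    E * (μ.χ₂ x * energyCurrentT ω u u₁ x + μ.χ₁ x * energyCurrentT ϖ u u₁ x)

/-- **The bulk of `Q'`**:
`2f'|u'|² − fV'|u|² − ½f'''|u|² + (h(|u'|² + (V − ω²)|u|²) − ½h''|u|²)
 + (y'(|u'|² + (ω² − V)|u|²) − yV'|u|²) − E(χ₂'ω + χ₁'ϖ) Im(u'ū)` (DRSR arXiv:1402.7034, §7.1 and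
the `χ₁'`-term of §8.3, Stage 3). [cite: DafermosRodnianskiShlapentokhrothman2014, §8.3] -/
def combinedBulk (ω ϖ E : ℝ) (V V' : ℝ → ℝ) (μ : Multipliers) (u u₁ : ℝ → ℂ) (x : ℝ) : ℝ :=
  2 * μ.f' x * ‖u₁ x‖ ^ 2 - μ.f x * V' x * ‖u x‖ ^ 2 - 1 / 2 * μ.f''' x * ‖u x‖ ^ 2 +
    (μ.h x * (‖u₁ x‖ ^ 2 + (V x - ω ^ 2) * ‖u x‖ ^ 2) - 1 / 2 * μ.h'' x * ‖u x‖ ^ 2) +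
    (μ.y' x * (‖u₁ x‖ ^ 2 + (ω ^ 2 - V x) * ‖u x‖ ^ 2) - μ.y x * V' x * ‖u x‖ ^ 2) -
    E * ((μ.χ₂' x * ω + μ.χ₁' x * ϖ) * (u₁ x * conj (u x)).im)

/-- **The source ("data") term**
`−2f Re(u'H̄) − (f' + h) Re(uH̄) − 2y Re(u'H̄) + E(χ₂ω + χ₁ϖ) Im(Hū)`
(`Re(u'H̄) = ⟪H, u'⟫_ℝ`, `Re(uH̄) = ⟪H, u⟫_ℝ`): the right-hand sides of DRSR arXiv:1402.7034,
Props. 8.3.1–8.6.1, cf. `H·(f, h, y, χ)·(u, u')` of Theorem 8.1. [cite: DafermosRodnianskiShlapentokhrothman2014, Thm. 8.1] -/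
def combinedSource (ω ϖ E : ℝ) (μ : Multipliers) (u u₁ H : ℝ → ℂ) (x : ℝ) : ℝ :=
  -(2 * μ.f x * ⟪H x, u₁ x⟫_ℝ) - (μ.f' x + μ.h x) * ⟪H x, u x⟫_ℝ - 2 * μ.y x * ⟪H x, u₁ x⟫_ℝ +
    E * ((μ.χ₂ x * ω + μ.χ₁ x * ϖ) * (H x * conj (u x)).im)

section Derivative

variable {ω ϖ E x : ℝ} {V V' : ℝ → ℝ} {μ : Multipliers} {u u₁ u₂ H : ℝ → ℂ}

/-- **`Q' = bulk − source`** for a solution of `u'' + (ω² − V)u = H` at `x`: the sum of the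
identities of DRSR arXiv:1402.7034, §7.1–§7.2 for `Q^f`, `Ϙ^h`, `ϟ^y`, `χ₂Q^T`, `χ₁Q^K`.
[cite: DafermosRodnianskiShlapentokhrothman2014, §7.1] -/
theorem hasDerivAt_combinedCurrent (hV : HasDerivAt V (V' x) x) (hμ : μ.HasDerivs)
    (hu : HasDerivAt u (u₁ x) x) (hu₁ : HasDerivAt u₁ (u₂ x) x)
    (hode : u₂ x + ((ω ^ 2 - V x : ℝ) : ℂ) * u x = H x) :
    HasDerivAt (combinedCurrent ω ϖ E V μ u u₁)
      (combinedBulk ω ϖ E V V' μ u u₁ x - combinedSource ω ϖ E μ u u₁ H x) x := by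
  have hQf := hasDerivAt_virialCurrent hV (hμ.df x) (hμ.df' x) (hμ.df'' x) hu hu₁ hode
  have hQh := hasDerivAt_qoppaCurrent (hμ.dh x) (hμ.dh' x) hu hu₁ hode
  have hQy := hasDerivAt_koppaCurrent hV (hμ.dy x) hu hu₁ hode
  have hT : HasDerivAt (fun t ↦ μ.χ₂ t * energyCurrentT ω u u₁ t)
      (μ.χ₂' x * energyCurrentT ω u u₁ x + μ.χ₂ x * (ω * (H x * conj (u x)).im)) x :=
    (hμ.dχ₂ x).mul (hasDerivAt_energyCurrentT hu hu₁ hode)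
  have hK : HasDerivAt (fun t ↦ μ.χ₁ t * energyCurrentT ϖ u u₁ t)
      (μ.χ₁' x * energyCurrentT ϖ u u₁ x + μ.χ₁ x * (ϖ * (H x * conj (u x)).im)) x :=
    (hμ.dχ₁ x).mul (hasDerivAt_energyCurrentT_of_ode ϖ hu hu₁ hode)
  have h : HasDerivAt (combinedCurrent ω ϖ E V μ u u₁)
      (2 * μ.f' x * ‖u₁ x‖ ^ 2 - μ.f x * V' x * ‖u x‖ ^ 2 +
          (2 * μ.f x * ⟪H x, u₁ x⟫_ℝ + μ.f' x * ⟪H x, u x⟫_ℝ) - 1 / 2 * μ.f''' x * ‖u x‖ ^ 2 +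
        (μ.h x * (‖u₁ x‖ ^ 2 + (V x - ω ^ 2) * ‖u x‖ ^ 2) - 1 / 2 * μ.h'' x * ‖u x‖ ^ 2 +
          μ.h x * ⟪H x, u x⟫_ℝ) +
        (μ.y' x * (‖u₁ x‖ ^ 2 + (ω ^ 2 - V x) * ‖u x‖ ^ 2) - μ.y x * V' x * ‖u x‖ ^ 2 +
          2 * μ.y x * ⟪H x, u₁ x⟫_ℝ) -
        E * (μ.χ₂' x * energyCurrentT ω u u₁ x + μ.χ₂ x * (ω * (H x * conj (u x)).im) +
          (μ.χ₁' x * energyCurrentT ϖ u u₁ x + μ.χ₁ x * (ϖ * (H x * conj (u x)).im)))) x :=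
    ((hQf.add hQh).add hQy).sub ((hT.add hK).const_mul E)
  refine h.congr_deriv ?_
  simp only [combinedBulk, combinedSource, energyCurrentT]
  ring

/-- The source term is continuous if `H` is (and `u`, the multipliers are differentiable).
[folklore] -/
theorem continuous_combinedSource (hμ : μ.HasDerivs) (hu : ∀ x, HasDerivAt u (u₁ x) x)
    (hu₁ : ∀ x, HasDerivAt u₁ (u₂ x) x) (hH : Continuous H) :
    Continuous (combinedSource ω ϖ E μ u u₁ H) := by
  have huc : Continuous u := continuous_iff_continuousAt.2 fun x ↦ (hu x).continuousAt
  have hu₁c : Continuous u₁ := continuous_iff_continuousAt.2 fun x ↦ (hu₁ x).continuousAt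
  have hf : Continuous μ.f := continuous_iff_continuousAt.2 fun x ↦ (hμ.df x).continuousAt
  have hf' : Continuous μ.f' := continuous_iff_continuousAt.2 fun x ↦ (hμ.df' x).continuousAt
  have hh : Continuous μ.h := continuous_iff_continuousAt.2 fun x ↦ (hμ.dh x).continuousAt
  have hy : Continuous μ.y := continuous_iff_continuousAt.2 fun x ↦ (hμ.dy x).continuousAt
  have hχ₁ : Continuous μ.χ₁ := continuous_iff_continuousAt.2 fun x ↦ (hμ.dχ₁ x).continuousAt
  have hχ₂ : Continuous μ.χ₂ := continuous_iff_continuousAt.2 fun x ↦ (hμ.dχ₂ x).continuousAt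
  have h1 : Continuous fun x ↦ ⟪H x, u₁ x⟫_ℝ := hH.inner hu₁c
  have h2 : Continuous fun x ↦ ⟪H x, u x⟫_ℝ := hH.inner huc
  have h3 : Continuous fun x ↦ (H x * conj (u x)).im :=
    Complex.continuous_im.comp (hH.mul (Complex.continuous_conj.comp huc))
  show Continuous fun x ↦ -(2 * μ.f x * ⟪H x, u₁ x⟫_ℝ) - (μ.f' x + μ.h x) * ⟪H x, u x⟫_ℝ -
    2 * μ.y x * ⟪H x, u₁ x⟫_ℝ + E * ((μ.χ₂ x * ω + μ.χ₁ x * ϖ) * (H x * conj (u x)).im)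
  exact ((((continuous_const.mul hf).mul h1).neg.sub ((hf'.add hh).mul h2)).sub
    ((continuous_const.mul hy).mul h1)).add (continuous_const.mul
      (((hχ₂.mul continuous_const).add (hχ₁.mul continuous_const)).mul h3))

end Derivative

/-! ### Boundary values of the combined current under (eq:b±) -/

section Ends

variable {ω ϖ E Atop Abot fi yi χ₁i χ₂i fh yh χ₁h χ₂h : ℝ} {V : ℝ → ℝ} {μ : Multipliers}
  {u u₁ : ℝ → ℂ}

/-- **`Q(∞)`** under (eq:b+): if `f → f_∞`, `y → y_∞`, `χᵢ → χᵢ_∞`, `f'', h' → 0` as `r* → ∞` then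
`Q → (2(f_∞ + y_∞)ω² − E(χ₂_∞ ω² + χ₁_∞ ϖω)) A_∞`; e.g. `(|u'|² + ω²|u|²)_{r=∞} = 2ω²A_∞` for
`f_∞ = 1` in (metastra), `−(E − 2)ω²|u(∞)|²`-type terms for `χ₂_∞ = 1`. DRSR arXiv:1402.7034, §8.2
((microEnergyEst)), §8.3 ((metastra)). [cite: DafermosRodnianskiShlapentokhrothman2014, §8.3] -/
theorem tendsto_combinedCurrent_atTop (hl : μ.EndLimits atTop fi yi χ₁i χ₂i)
    (hb : OutgoingBoundary ω ϖ V u u₁ Atop Abot) :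
    Tendsto (combinedCurrent ω ϖ E V μ u u₁) atTop
      (𝓝 ((2 * (fi + yi) * ω ^ 2 - E * (χ₂i * ω ^ 2 + χ₁i * ϖ * ω)) * Atop)) := by
  obtain ⟨c₁, hc₁⟩ := hl.tendsto_f'
  obtain ⟨c₂, hc₂⟩ := hl.tendsto_h
  have hQf := tendsto_virialCurrent (ω := ω) hl.tendsto_f hc₁ hl.tendsto_f'' hb.potential_top
    hb.sub_top hb.normSq_top
  have hQh := tendsto_qoppaCurrent hc₂ hl.tendsto_h' hb.sub_top hb.normSq_top
  have hQy := tendsto_koppaCurrent (ω := ω) hl.tendsto_y hb.potential_top hb.sub_top hb.normSq_top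
  have hT := (tendsto_energyCurrentT (ω := ω) hb.sub_top hb.normSq_top)
  have hK := (tendsto_energyCurrentT (ω := ϖ) hb.sub_top hb.normSq_top)
  have h : Tendsto (combinedCurrent ω ϖ E V μ u u₁) atTop
      (𝓝 (fi * (‖Complex.I * ω‖ ^ 2 * Atop + (ω ^ 2 - 0) * Atop) +
            (c₁ * ((Complex.I * ω).re * Atop) - 1 / 2 * 0 * Atop) +
          (c₂ * ((Complex.I * ω).re * Atop) - 1 / 2 * 0 * Atop) +
          yi * (‖Complex.I * ω‖ ^ 2 * Atop + (ω ^ 2 - 0) * Atop) -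
          E * (χ₂i * (ω * ((Complex.I * ω).im * Atop)) +
            χ₁i * (ϖ * ((Complex.I * ω).im * Atop))))) :=
    ((hQf.add hQh).add hQy).sub (((hl.tendsto_χ₂.mul hT).add (hl.tendsto_χ₁.mul hK)).const_mul E)
  rw [norm_I_mul_ofReal_sq, I_mul_ofReal_re, I_mul_ofReal_im] at h
  convert h using 2
  ring

/-- **`Q(−∞)`** under (eq:b−): if `f → f_H`, `y → y_H`, `χᵢ → χᵢ_H`, `f'', h' → 0` as `r* → −∞`
then `Q → (2(f_H + y_H)ϖ² + E(χ₂_H ωϖ + χ₁_H ϖ²)) A_H`; e.g.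
`−(|u'|² + (ω − ω₊m)²|u|²)_{r=r₊} = −2ϖ²A_H` for `f_H = −1` in (metastra), `−Q^T(−∞) = ωϖA_H` in
(microEnergyEst), `−Q^K(−∞) = ϖ²A_H` in Stage 3 of §8.3. DRSR arXiv:1402.7034, §8.2–§8.3.
[cite: DafermosRodnianskiShlapentokhrothman2014, §8.3] -/
theorem tendsto_combinedCurrent_atBot (hl : μ.EndLimits atBot fh yh χ₁h χ₂h)
    (hb : OutgoingBoundary ω ϖ V u u₁ Atop Abot) :
    Tendsto (combinedCurrent ω ϖ E V μ u u₁) atBot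
      (𝓝 ((2 * (fh + yh) * ϖ ^ 2 + E * (χ₂h * ω * ϖ + χ₁h * ϖ ^ 2)) * Abot)) := by
  obtain ⟨c₁, hc₁⟩ := hl.tendsto_f'
  obtain ⟨c₂, hc₂⟩ := hl.tendsto_h
  have hQf := tendsto_virialCurrent (ω := ω) hl.tendsto_f hc₁ hl.tendsto_f'' hb.potential_bot
    hb.sub_bot hb.normSq_bot
  have hQh := tendsto_qoppaCurrent hc₂ hl.tendsto_h' hb.sub_bot hb.normSq_bot
  have hQy := tendsto_koppaCurrent (ω := ω) hl.tendsto_y hb.potential_bot hb.sub_bot hb.normSq_bot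
  have hT := (tendsto_energyCurrentT (ω := ω) hb.sub_bot hb.normSq_bot)
  have hK := (tendsto_energyCurrentT (ω := ϖ) hb.sub_bot hb.normSq_bot)
  have h : Tendsto (combinedCurrent ω ϖ E V μ u u₁) atBot
      (𝓝 (fh * (‖-(Complex.I * ϖ)‖ ^ 2 * Abot + (ω ^ 2 - (ω ^ 2 - ϖ ^ 2)) * Abot) +
            (c₁ * ((-(Complex.I * ϖ)).re * Abot) - 1 / 2 * 0 * Abot) +
          (c₂ * ((-(Complex.I * ϖ)).re * Abot) - 1 / 2 * 0 * Abot) +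
          yh * (‖-(Complex.I * ϖ)‖ ^ 2 * Abot + (ω ^ 2 - (ω ^ 2 - ϖ ^ 2)) * Abot) -
          E * (χ₂h * (ω * ((-(Complex.I * ϖ)).im * Abot)) +
            χ₁h * (ϖ * ((-(Complex.I * ϖ)).im * Abot))))) :=
    ((hQf.add hQh).add hQy).sub (((hl.tendsto_χ₂.mul hT).add (hl.tendsto_χ₁.mul hK)).const_mul E)
  rw [norm_neg, norm_I_mul_ofReal_sq, Complex.neg_re, Complex.neg_im, I_mul_ofReal_re,
    I_mul_ofReal_im] at h
  convert h using 2
  ring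

end Ends

/-! ### The integrated identity and the integrability of a non-negative bulk -/

section Identity

variable {ω ϖ E : ℝ} {V V' : ℝ → ℝ} {μ : Multipliers} {u u₁ u₂ H : ℝ → ℂ}

/-- **`∫ Q' = Q(∞) − Q(−∞)`**, i.e. `∫ bulk = Q(∞) − Q(−∞) + ∫ source`, for a solution of
`u'' + (ω² − V)u = H` on `ℝ` with integrable bulk and source and a current with limits `qbot`,
`qtop` at `∓∞`. DRSR arXiv:1402.7034, §8.2 (the identities (metastra), (metatastra2),
(whatweobtainh), (someEstimateWithA), … of §8 are its instances). [cite: DafermosRodnianskiShlapentokhrothman2014, §8.2] -/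
theorem integral_combinedBulk_eq {qbot qtop : ℝ} (hV : ∀ x, HasDerivAt V (V' x) x)
    (hμ : μ.HasDerivs) (hu : ∀ x, HasDerivAt u (u₁ x) x) (hu₁ : ∀ x, HasDerivAt u₁ (u₂ x) x)
    (hode : ∀ x, u₂ x + ((ω ^ 2 - V x : ℝ) : ℂ) * u x = H x)
    (hP : Integrable (combinedBulk ω ϖ E V V' μ u u₁))
    (hS : Integrable (combinedSource ω ϖ E μ u u₁ H))
    (hbot : Tendsto (combinedCurrent ω ϖ E V μ u u₁) atBot (𝓝 qbot))
    (htop : Tendsto (combinedCurrent ω ϖ E V μ u u₁) atTop (𝓝 qtop)) :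
    ∫ x, combinedBulk ω ϖ E V V' μ u u₁ x =
      qtop - qbot + ∫ x, combinedSource ω ϖ E μ u u₁ H x := by
  have hderiv := fun x ↦ hasDerivAt_combinedCurrent (ϖ := ϖ) (E := E) (hV x) hμ (hu x) (hu₁ x)
    (hode x)
  have hI : Integrable (fun x ↦ combinedBulk ω ϖ E V V' μ u u₁ x - combinedSource ω ϖ E μ u u₁ H x) :=
    hP.sub hS
  have hftc := integral_of_hasDerivAt_of_tendsto hderiv hI hbot htop
  rw [integral_sub hP hS] at hftc
  linarith

/-- **A non-negative bulk is integrable**: if moreover `H` is continuous and the bulk is `≥ 0`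
pointwise then it is integrable on `ℝ` (so that no integrability hypothesis on the left-hand sides
of the estimates of §8 is needed). Implicit in DRSR arXiv:1402.7034, §8. [folklore] -/
theorem integrable_combinedBulk_of_nonneg {qbot qtop : ℝ} (hV : ∀ x, HasDerivAt V (V' x) x)
    (hμ : μ.HasDerivs) (hu : ∀ x, HasDerivAt u (u₁ x) x) (hu₁ : ∀ x, HasDerivAt u₁ (u₂ x) x)
    (hode : ∀ x, u₂ x + ((ω ^ 2 - V x : ℝ) : ℂ) * u x = H x) (hH : Continuous H)
    (hS : Integrable (combinedSource ω ϖ E μ u u₁ H))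
    (hbot : Tendsto (combinedCurrent ω ϖ E V μ u u₁) atBot (𝓝 qbot))
    (htop : Tendsto (combinedCurrent ω ϖ E V μ u u₁) atTop (𝓝 qtop))
    (hP0 : ∀ x, 0 ≤ combinedBulk ω ϖ E V V' μ u u₁ x) :
    Integrable (combinedBulk ω ϖ E V V' μ u u₁) := by
  have hSc : Continuous (combinedSource ω ϖ E μ u u₁ H) :=
    continuous_combinedSource hμ hu hu₁ hH
  have hderiv : ∀ x, HasDerivAt (combinedCurrent ω ϖ E V μ u u₁)
      (combinedBulk ω ϖ E V V' μ u u₁ x + -combinedSource ω ϖ E μ u u₁ H x) x := fun x ↦ by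
    simpa only [← sub_eq_add_neg] using
      hasDerivAt_combinedCurrent (ϖ := ϖ) (E := E) (hV x) hμ (hu x) (hu₁ x) (hode x)
  exact integrable_of_hasDerivAt_add_of_nonneg hderiv hP0 hS.neg hSc.neg hbot htop

end Identity

/-! ### "Bulk coercivity + boundary positivity ⇒ estimate" (§8.2) -/

section Estimate

variable {ω ϖ E b R₁ R₂ Atop Abot fi yi χ₁i χ₂i fh yh χ₁h χ₂h : ℝ} {V V' w : ℝ → ℝ}
  {μ : Multipliers} {u u₁ u₂ H : ℝ → ℂ}

/-- Restriction of the domain of integration ("One restricts the domain of integration on the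
first term to `[R₋*, R₊*]`", DRSR arXiv:1402.7034, §8.2): if `P ≥ 0` is integrable on `ℝ` and
`P ≥ g` on `[R₁, R₂]` with `g` continuous, then `∫_{R₁}^{R₂} g ≤ ∫_ℝ P`. [folklore] -/
theorem intervalIntegral_le_integral_of_nonneg {P g : ℝ → ℝ} (hP : Integrable P)
    (hP0 : ∀ x, 0 ≤ P x) (hg : Continuous g) (hR : R₁ ≤ R₂) (hle : ∀ x ∈ Icc R₁ R₂, g x ≤ P x) :
    ∫ x in R₁..R₂, g x ≤ ∫ x, P x := by
  have hstep1 : ∫ x in R₁..R₂, g x ≤ ∫ x in R₁..R₂, P x :=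
    intervalIntegral.integral_mono_on hR (hg.intervalIntegrable _ _) hP.intervalIntegrable hle
  have hstep2 : ∫ x in R₁..R₂, P x ≤ ∫ x, P x := by
    rw [intervalIntegral.integral_of_le hR]
    exact setIntegral_le_integral hP (Eventually.of_forall hP0)
  exact hstep1.trans hstep2

/-- **The deduction of §8.2** ("bulk coercivity + boundary terms ⇒ estimate"), abstract form with
the boundary contribution explicit. Let `u` solve `u'' + (ω² − V)u = H` on `ℝ` (`H` continuous,
source integrable) with the boundary behaviour (eq:b±) (`|u|² → A_∞, A_H`), and let the multipliers
have end limits `(f_∞, y_∞, χ₁_∞, χ₂_∞)` at `r* = ∞` and `(f_H, y_H, χ₁_H, χ₂_H)` at the horizon end.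
If the bulk of `Q = Q^f + Ϙ^h + ϟ^y − E(χ₂Q^T + χ₁Q^K)` is non-negative on `ℝ` and
`≥ b(|u'|² + w|u|²)` on `[R₁, R₂]` (the coercivity (yaxvw), `w` a continuous weight such as
`(1 − r⁻¹r_trap)²(Λ + ω²) + 1`), then
`b ∫_{R₁}^{R₂} (|u'|² + w|u|²) ≤ ∫ source + (Q(∞) − Q(−∞))` with
`Q(∞) = (2(f_∞ + y_∞)ω² − E(χ₂_∞ω² + χ₁_∞ϖω)) A_∞`,
`Q(−∞) = (2(f_H + y_H)ϖ² + E(χ₂_H ωϖ + χ₁_H ϖ²)) A_H`. DRSR arXiv:1402.7034, §8.2 ((yaxvw),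
(boundaryOK)/(boundaryNotOK) ⇒ (fromPhaseSpace2)). [cite: DafermosRodnianskiShlapentokhrothman2014, §8.2] -/
theorem combined_estimate (hV : ∀ x, HasDerivAt V (V' x) x) (hμ : μ.HasDerivs)
    (hu : ∀ x, HasDerivAt u (u₁ x) x) (hu₁ : ∀ x, HasDerivAt u₁ (u₂ x) x)
    (hode : ∀ x, u₂ x + ((ω ^ 2 - V x : ℝ) : ℂ) * u x = H x) (hH : Continuous H)
    (hS : Integrable (combinedSource ω ϖ E μ u u₁ H))
    (hb : OutgoingBoundary ω ϖ V u u₁ Atop Abot)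
    (htop : μ.EndLimits atTop fi yi χ₁i χ₂i) (hbot : μ.EndLimits atBot fh yh χ₁h χ₂h)
    (hP0 : ∀ x, 0 ≤ combinedBulk ω ϖ E V V' μ u u₁ x) (hw : Continuous w) (hR : R₁ ≤ R₂)
    (hcoer : ∀ x ∈ Icc R₁ R₂,
      b * (‖u₁ x‖ ^ 2 + w x * ‖u x‖ ^ 2) ≤ combinedBulk ω ϖ E V V' μ u u₁ x) :
    b * ∫ x in R₁..R₂, (‖u₁ x‖ ^ 2 + w x * ‖u x‖ ^ 2) ≤
      (∫ x, combinedSource ω ϖ E μ u u₁ H x) +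
        ((2 * (fi + yi) * ω ^ 2 - E * (χ₂i * ω ^ 2 + χ₁i * ϖ * ω)) * Atop -
          (2 * (fh + yh) * ϖ ^ 2 + E * (χ₂h * ω * ϖ + χ₁h * ϖ ^ 2)) * Abot) := by
  have hQtop := tendsto_combinedCurrent_atTop (E := E) htop hb
  have hQbot := tendsto_combinedCurrent_atBot (E := E) hbot hb
  have hP : Integrable (combinedBulk ω ϖ E V V' μ u u₁) :=
    integrable_combinedBulk_of_nonneg hV hμ hu hu₁ hode hH hS hQbot hQtop hP0
  have hid := integral_combinedBulk_eq hV hμ hu hu₁ hode hP hS hQbot hQtop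
  have huc : Continuous u := continuous_iff_continuousAt.2 fun x ↦ (hu x).continuousAt
  have hu₁c : Continuous u₁ := continuous_iff_continuousAt.2 fun x ↦ (hu₁ x).continuousAt
  have hmc : Continuous fun x ↦ b * (‖u₁ x‖ ^ 2 + w x * ‖u x‖ ^ 2) := by fun_prop
  have hle := intervalIntegral_le_integral_of_nonneg hP hP0 hmc hR hcoer
  rw [intervalIntegral.integral_const_mul] at hle
  linarith

/-- **(yaxvw) + (boundaryOK) ⇒ the estimate**, the form used in the non-superradiant and in the
large superradiant ranges: if in the situation of `combined_estimate` the boundary coefficients have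
the good signs, `2(f_∞ + y_∞)ω² ≤ E(χ₂_∞ω² + χ₁_∞ϖω)` at `r* = ∞` and
`0 ≤ 2(f_H + y_H)ϖ² + E(χ₂_H ωϖ + χ₁_H ϖ²)` at the horizon (this is how "`E ≥ 2`", the
non-superradiance `ω(ω − ω₊m) ≥ 0`, `f(r₊) = −1, f(∞) = 1`, `χ₁ = 1` near `r₊`, `χ₂ = 1` near `∞`
enter in §8.3–§8.6), then `b ∫_{R₁}^{R₂} (|u'|² + w|u|²) ≤ ∫ source`. DRSR arXiv:1402.7034, §8.2.
[cite: DafermosRodnianskiShlapentokhrothman2014, §8.2] -/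
theorem combined_estimate_of_boundary_sign (hV : ∀ x, HasDerivAt V (V' x) x) (hμ : μ.HasDerivs)
    (hu : ∀ x, HasDerivAt u (u₁ x) x) (hu₁ : ∀ x, HasDerivAt u₁ (u₂ x) x)
    (hode : ∀ x, u₂ x + ((ω ^ 2 - V x : ℝ) : ℂ) * u x = H x) (hH : Continuous H)
    (hS : Integrable (combinedSource ω ϖ E μ u u₁ H))
    (hb : OutgoingBoundary ω ϖ V u u₁ Atop Abot)
    (htop : μ.EndLimits atTop fi yi χ₁i χ₂i) (hbot : μ.EndLimits atBot fh yh χ₁h χ₂h)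
    (hP0 : ∀ x, 0 ≤ combinedBulk ω ϖ E V V' μ u u₁ x) (hw : Continuous w) (hR : R₁ ≤ R₂)
    (hcoer : ∀ x ∈ Icc R₁ R₂,
      b * (‖u₁ x‖ ^ 2 + w x * ‖u x‖ ^ 2) ≤ combinedBulk ω ϖ E V V' μ u u₁ x)
    (hsign_top : 2 * (fi + yi) * ω ^ 2 ≤ E * (χ₂i * ω ^ 2 + χ₁i * ϖ * ω))
    (hsign_bot : 0 ≤ 2 * (fh + yh) * ϖ ^ 2 + E * (χ₂h * ω * ϖ + χ₁h * ϖ ^ 2)) :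
    b * ∫ x in R₁..R₂, (‖u₁ x‖ ^ 2 + w x * ‖u x‖ ^ 2) ≤ ∫ x, combinedSource ω ϖ E μ u u₁ H x := by
  have h := combined_estimate hV hμ hu hu₁ hode hH hS hb htop hbot hP0 hw hR hcoer
  have h1 : 0 ≤ (E * (χ₂i * ω ^ 2 + χ₁i * ϖ * ω) - 2 * (fi + yi) * ω ^ 2) * Atop :=
    mul_nonneg (sub_nonneg.2 hsign_top) hb.nonneg_top
  have h2 : 0 ≤ (2 * (fh + yh) * ϖ ^ 2 + E * (χ₂h * ω * ϖ + χ₁h * ϖ ^ 2)) * Abot :=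
    mul_nonneg hsign_bot hb.nonneg_bot
  nlinarith [h1, h2]

end Estimate

/-! ### Printed instances: (metastra), (microEnergyEst), and the `χ₁Q^K` argument of §8.3 -/

section Instances

variable {ω ϖ E Atop Abot : ℝ} {V V' f f' f'' f''' χ χ' : ℝ → ℝ} {u u₁ u₂ H : ℝ → ℂ}

/-- The bulk of a pure virial current: `2f'|u'|² − fV'|u|² − ½f'''|u|²`. [folklore] -/
theorem combinedBulk_virial (x : ℝ) :
    combinedBulk ω ϖ E V V' (Multipliers.virial f f' f'' f''') u u₁ x =
      2 * f' x * ‖u₁ x‖ ^ 2 - f x * V' x * ‖u x‖ ^ 2 - 1 / 2 * f''' x * ‖u x‖ ^ 2 := by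
  simp only [combinedBulk, Multipliers.virial, Pi.zero_apply]
  ring

/-- The source of a pure virial current: `−(2f Re(u'H̄) + f' Re(uH̄))`. [folklore] -/
theorem combinedSource_virial (x : ℝ) :
    combinedSource ω ϖ E (Multipliers.virial f f' f'' f''') u u₁ H x =
      -(2 * f x * ⟪H x, u₁ x⟫_ℝ + f' x * ⟪H x, u x⟫_ℝ) := by
  simp only [combinedSource, Multipliers.virial, Pi.zero_apply]
  ring

/-- **(metastra)** (DRSR arXiv:1402.7034, §8.3, Stage 1 of the proof of Prop. 8.3.1): for the
current `Q^f` with `f → −1` at the horizon end, `f → 1` at infinity (`f'` convergent, `f'' → 0` at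
both ends) and a solution of `u'' + (ω² − V)u = H` obeying (eq:b±),
`∫ (2f'|u'|² − fV'|u|² − ½f'''|u|²) = (|u'|² + (ω − ω₊m)²|u|²)_{r=r₊} + (|u'|² + ω²|u|²)_{r=∞}
  − ∫ (2f Re(u'H̄) + f' Re(uH̄))`,
the two boundary brackets being `2ϖ²A_H` and `2ω²A_∞` (`ϖ = ω − ω₊m`). Here with the integrability
of bulk and source as hypotheses (in loc. cit. the bulk is subsequently made non-negative, cf.
`integrable_combinedBulk_of_nonneg`). [cite: DafermosRodnianskiShlapentokhrothman2014, Prop. 8.3.1 (proof, Stage 1)] -/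
theorem integral_virialBulk_eq {ci ch : ℝ} (hV : ∀ x, HasDerivAt V (V' x) x)
    (hf : ∀ x, HasDerivAt f (f' x) x) (hf' : ∀ x, HasDerivAt f' (f'' x) x)
    (hf'' : ∀ x, HasDerivAt f'' (f''' x) x)
    (hu : ∀ x, HasDerivAt u (u₁ x) x) (hu₁ : ∀ x, HasDerivAt u₁ (u₂ x) x)
    (hode : ∀ x, u₂ x + ((ω ^ 2 - V x : ℝ) : ℂ) * u x = H x)
    (hb : OutgoingBoundary ω ϖ V u u₁ Atop Abot)
    (hfi : Tendsto f atTop (𝓝 1)) (hfi' : Tendsto f' atTop (𝓝 ci)) (hfi'' : Tendsto f'' atTop (𝓝 0))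
    (hfh : Tendsto f atBot (𝓝 (-1))) (hfh' : Tendsto f' atBot (𝓝 ch))
    (hfh'' : Tendsto f'' atBot (𝓝 0))
    (hP : Integrable fun x ↦ 2 * f' x * ‖u₁ x‖ ^ 2 - f x * V' x * ‖u x‖ ^ 2 -
      1 / 2 * f''' x * ‖u x‖ ^ 2)
    (hS : Integrable fun x ↦ 2 * f x * ⟪H x, u₁ x⟫_ℝ + f' x * ⟪H x, u x⟫_ℝ) :
    ∫ x, (2 * f' x * ‖u₁ x‖ ^ 2 - f x * V' x * ‖u x‖ ^ 2 - 1 / 2 * f''' x * ‖u x‖ ^ 2) =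
      2 * ϖ ^ 2 * Abot + 2 * ω ^ 2 * Atop -
        ∫ x, (2 * f x * ⟪H x, u₁ x⟫_ℝ + f' x * ⟪H x, u x⟫_ℝ) := by
  have hμ : (Multipliers.virial f f' f'' f''').HasDerivs := Multipliers.hasDerivs_virial hf hf' hf''
  have htop : (Multipliers.virial f f' f'' f''').EndLimits atTop 1 0 0 0 :=
    Multipliers.endLimits_virial hfi hfi' hfi''
  have hbot : (Multipliers.virial f f' f'' f''').EndLimits atBot (-1) 0 0 0 :=
    Multipliers.endLimits_virial hfh hfh' hfh''
  have hQtop := tendsto_combinedCurrent_atTop (E := 0) htop hb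
  have hQbot := tendsto_combinedCurrent_atBot (E := 0) hbot hb
  have hP' : Integrable (combinedBulk ω ϖ 0 V V' (Multipliers.virial f f' f'' f''') u u₁) :=
    hP.congr (Eventually.of_forall fun x ↦ (combinedBulk_virial x).symm)
  have hS' : Integrable (combinedSource ω ϖ 0 (Multipliers.virial f f' f'' f''') u u₁ H) :=
    hS.neg.congr (Eventually.of_forall fun x ↦ (combinedSource_virial x).symm)
  have hid := integral_combinedBulk_eq hV hμ hu hu₁ hode hP' hS' hQbot hQtop
  have h1 : ∫ x, combinedBulk ω ϖ 0 V V' (Multipliers.virial f f' f'' f''') u u₁ x =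
      ∫ x, (2 * f' x * ‖u₁ x‖ ^ 2 - f x * V' x * ‖u x‖ ^ 2 - 1 / 2 * f''' x * ‖u x‖ ^ 2) :=
    integral_congr_ae (Eventually.of_forall fun x ↦ combinedBulk_virial x)
  have h2 : ∫ x, combinedSource ω ϖ 0 (Multipliers.virial f f' f'' f''') u u₁ H x =
      -∫ x, (2 * f x * ⟪H x, u₁ x⟫_ℝ + f' x * ⟪H x, u x⟫_ℝ) := by
    rw [← integral_neg]
    exact integral_congr_ae (Eventually.of_forall fun x ↦ combinedSource_virial x)
  rw [h1, h2] at hid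
  rw [hid]
  ring

/-- **(microEnergyEst)** (DRSR arXiv:1402.7034, §8.2): for a solution of `u'' + (ω² − V)u = H`
obeying (eq:b±), `∫ (Q^T)' = Q^T(∞) − Q^T(−∞)`, i.e.
`∫ ω Im(Hū) = ω²|u(∞)|² + ω(ω − ω₊m)|u(−∞)|²` (`= ω²A_∞ + ωϖA_H`; loc. cit. prints the left-hand
side as `∫ Im(Hū)`). [cite: DafermosRodnianskiShlapentokhrothman2014, §8.2] -/
theorem integral_omega_mul_im_eq (hu : ∀ x, HasDerivAt u (u₁ x) x)
    (hu₁ : ∀ x, HasDerivAt u₁ (u₂ x) x) (hode : ∀ x, u₂ x + ((ω ^ 2 - V x : ℝ) : ℂ) * u x = H x)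
    (hb : OutgoingBoundary ω ϖ V u u₁ Atop Abot)
    (hS : Integrable fun x ↦ (H x * conj (u x)).im) :
    ∫ x, ω * (H x * conj (u x)).im = ω ^ 2 * Atop + ω * ϖ * Abot := by
  have hderiv := fun x ↦ hasDerivAt_energyCurrentT (hu x) (hu₁ x) (hode x)
  have htop := tendsto_energyCurrentT_atTop hb.sub_top hb.normSq_top
  have hbot := tendsto_energyCurrentT_atBot (ω := ω) hb.add_bot hb.normSq_bot
  have h := integral_of_hasDerivAt_of_tendsto hderiv (hS.const_mul ω) hbot htop
  rw [h]
  ring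

/-- **The `χ₁Q^K` identity of Stage 3** (DRSR arXiv:1402.7034, §8.3): for a cut-off `χ` with
`χ → 1` at the horizon end and `χ → 0` at infinity,
`∫ (χQ^K)' = −χ(−∞)Q^K(−∞) = (ω − ω₊m)²|u(−∞)|²`, i.e.
`∫ χ'ϖ Im(u'ū) + ∫ χϖ Im(Hū) = ϖ²A_H`. [cite: DafermosRodnianskiShlapentokhrothman2014, Prop. 8.3.1 (proof, Stage 3)] -/
theorem integral_cutoff_flux_eq (hχ : ∀ x, HasDerivAt χ (χ' x) x)
    (hu : ∀ x, HasDerivAt u (u₁ x) x) (hu₁ : ∀ x, HasDerivAt u₁ (u₂ x) x)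
    (hode : ∀ x, u₂ x + ((ω ^ 2 - V x : ℝ) : ℂ) * u x = H x)
    (hb : OutgoingBoundary ω ϖ V u u₁ Atop Abot)
    (hχi : Tendsto χ atTop (𝓝 0)) (hχh : Tendsto χ atBot (𝓝 1))
    (hS₁ : Integrable fun x ↦ χ' x * (ϖ * (u₁ x * conj (u x)).im))
    (hS₂ : Integrable fun x ↦ χ x * (ϖ * (H x * conj (u x)).im)) :
    (∫ x, χ' x * (ϖ * (u₁ x * conj (u x)).im)) + ∫ x, χ x * (ϖ * (H x * conj (u x)).im) =
      ϖ ^ 2 * Abot := by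
  have hderiv : ∀ x, HasDerivAt (fun t ↦ χ t * energyCurrentT ϖ u u₁ t)
      (χ' x * (ϖ * (u₁ x * conj (u x)).im) + χ x * (ϖ * (H x * conj (u x)).im)) x := fun x ↦
    (hχ x).mul (hasDerivAt_energyCurrentT_of_ode ϖ (hu x) (hu₁ x) (hode x))
  have hT_top : Tendsto (energyCurrentT ϖ u u₁) atTop (𝓝 (ϖ * ((Complex.I * ω).im * Atop))) :=
    tendsto_energyCurrentT hb.sub_top hb.normSq_top
  have hT_bot : Tendsto (energyCurrentT ϖ u u₁) atBot
      (𝓝 (ϖ * ((-(Complex.I * ϖ)).im * Abot))) :=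
    tendsto_energyCurrentT hb.sub_bot hb.normSq_bot
  have hI : Integrable fun x ↦
      χ' x * (ϖ * (u₁ x * conj (u x)).im) + χ x * (ϖ * (H x * conj (u x)).im) := hS₁.add hS₂
  have h := integral_of_hasDerivAt_of_tendsto hderiv hI (hχh.mul hT_bot) (hχi.mul hT_top)
  rw [integral_add hS₁ hS₂] at h
  rw [h, Complex.neg_im, I_mul_ofReal_im, I_mul_ofReal_im]
  ring

/-- **The horizon-flux control of Stage 3** (DRSR arXiv:1402.7034, §8.3, "Since `E ≥ 2`, we have
`(|u'|² + (ω − ω₊m)²|u|²)_{r=r₊} ≤ E ∫ (χ₁Q^K)' = E ∫ χ₁'(ω − ω₊m) Im(u'ū) + E ∫ χ₁(ω − ω₊m) Im(Hū)`"):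
with `(|u'|² + (ω − ω₊m)²|u|²)_{r=r₊} = 2ϖ²A_H` under (eq:b−),
`2ϖ²A_H ≤ E(∫ χ'ϖ Im(u'ū) + ∫ χϖ Im(Hū))` for every `E ≥ 2` and every cut-off `χ` with `χ → 1`
at the horizon end, `χ → 0` at infinity. [cite: DafermosRodnianskiShlapentokhrothman2014, Prop. 8.3.1 (proof, Stage 3)] -/
theorem horizonFlux_le_mul_integral_cutoff (hχ : ∀ x, HasDerivAt χ (χ' x) x)
    (hu : ∀ x, HasDerivAt u (u₁ x) x) (hu₁ : ∀ x, HasDerivAt u₁ (u₂ x) x)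
    (hode : ∀ x, u₂ x + ((ω ^ 2 - V x : ℝ) : ℂ) * u x = H x)
    (hb : OutgoingBoundary ω ϖ V u u₁ Atop Abot)
    (hχi : Tendsto χ atTop (𝓝 0)) (hχh : Tendsto χ atBot (𝓝 1))
    (hS₁ : Integrable fun x ↦ χ' x * (ϖ * (u₁ x * conj (u x)).im))
    (hS₂ : Integrable fun x ↦ χ x * (ϖ * (H x * conj (u x)).im)) (hE : 2 ≤ E) :
    2 * ϖ ^ 2 * Abot ≤
      E * ((∫ x, χ' x * (ϖ * (u₁ x * conj (u x)).im)) + ∫ x, χ x * (ϖ * (H x * conj (u x)).im)) := by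
  rw [integral_cutoff_flux_eq hχ hu hu₁ hode hb hχi hχh hS₁ hS₂]
  have h0 : 0 ≤ ϖ ^ 2 * Abot := mul_nonneg (sq_nonneg ϖ) hb.nonneg_bot
  nlinarith

end Instances

end Kerr

end Literature.Geometry.Lorentzian

end
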